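import Summits.Ventures.PercRepro.S1TailAB
import Summits.Ventures.PercRepro.S1LevelFourH

/-!
# PercRepro — S1 LEVEL FOUR, PHASE 9: C-025 at level `4` for every finite matroid and every `p ≥ 13` (p2, gen 16;
SUBCLAIM-S1 with LEMMAS J, J′, K, L1, A, B, `R₃` at `7/5`, and p1 g20/g21's LEMMAS T⁺⁺⁺ and T4⁺)

The cell inequality with the flat profile (`S1CellTableAB.cellOK8`) closes every core cell `(13, d)`: `5 ≤ d ≤ 15`
by `table_13`, `16 ≤ d ≤ 400` by `table_13_16_400`, `d ≥ 401` by `cellOK8_of_tail`. With level `3` at rank `12`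
(`SevenThree.c025_three_all`) the fixed-rank frame `S1FixedFrame.rls_succ_fixed 3 4 13` gives level `4` at `p = 13`;
`S1LevelFourH.c025_four_fourteen` covers `p ≥ 14`.

* `c025_core_four_thirteen` — the core of rank `13` at every corank `≥ 5`;
* `c025_four_thirteen_fixed` — `ThmN.RLS M 13 4`;
* **`c025_four_thirteen`** — THE END THEOREM: `ThmN.RLS M p 4` for every finite matroid and every `p ≥ 13`;
  `c025_four_thirteen'` — the literal `C025` body.
Axioms: standard.
-/

open scoped Matroid

namespace PercRepro

namespace S1

variable {α : Type}

/-- **The `e`-free core of rank `13` at every corank `≥ 5`.** -/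
theorem c025_core_four_thirteen (M : Matroid α) [M.Finite] (hR : M.eRank = (13 : ℕ)) (hbig : 13 + 4 < M.E.ncard)
    (hfree : ∀ e ∈ M.E, ∃ A ⊆ M.E \ {e}, e ∉ M.closure A ∧ e ∉ M.closure ((M.E \ {e}) \ A)) :
    ThmN.RLS M 13 4 := by
  set d := M.E.ncard - 13 with hd
  have hn : M.E.ncard = 13 + d := by omega
  rcases Nat.lt_or_ge d 16 with h16 | h16
  · exact rls_of_cellOK8 M 13 d (by omega) hR hn hfree (by norm_num) (table_13 d (by omega) (by omega))
  rcases Nat.lt_or_ge d 401 with h401 | h401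
  · exact rls_of_cellOK8 M 13 d (by omega) hR hn hfree (by norm_num) (table_13_16_400 d h401 h16)
  · exact rls_of_cellOK8 M 13 d (by omega) hR hn hfree (by norm_num) (cellOK8_of_tail d h401)

/-- **Level `4` at rank `13`** (the fixed-rank frame). -/
theorem c025_four_thirteen_fixed (M : Matroid α) [M.Finite] : ThmN.RLS M 13 4 := by
  refine rls_succ_fixed (α := α) 3 4 13 (by omega) ?_ ?_ ?_ M
  · intro M' _
    exact SevenThree.c025_three_all M' 12 (by omega)
  · intro M' _ hn
    rcases Nat.lt_or_ge M'.E.ncard (13 + 4) with h | h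
    · exact ThmN.RLS_of_ncard_lt M' h
    · exact ThmN.RLS_of_ncard_eq M' (by omega)
  · intro M' _ hR hbig hfree
    exact c025_core_four_thirteen M' hR hbig hfree

/-- **THE END THEOREM OF PHASE 9**: every finite matroid satisfies C-025 at level `4` for every `p ≥ 13`:
`Φ(p, 4)·#{A ⊆ E : r(A) = p, r(E ∖ A) = 4} ≤ #{A ⊆ E : 4 < r(A) < p}`. -/
theorem c025_four_thirteen (M : Matroid α) [M.Finite] (p : ℕ) (hp : 13 ≤ p) : ThmN.RLS M p 4 := by
  rcases Nat.lt_or_ge p 14 with h | h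
  · have hp13 : p = 13 := by omega
    subst hp13
    exact c025_four_thirteen_fixed M
  · exact c025_four_fourteen M p h

/-- The phase-9 theorem in the literal vocabulary of `C025` (the body at `(p, 4)`). -/
theorem c025_four_thirteen' (M : Matroid α) [M.Finite] (p : ℕ) (hp : 13 ≤ p) :
    phiK p 4 * ({A : Set α | A ⊆ M.E ∧ M.eRk A = (p : ℕ∞) ∧ M.eRk (M.E \ A) = (4 : ℕ∞)}.ncard : ℚ) ≤
      ({A : Set α | A ⊆ M.E ∧ (4 : ℕ∞) < M.eRk A ∧ M.eRk A < (p : ℕ∞)}.ncard : ℚ) :=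
  c025_four_thirteen M p hp

end S1

end PercRepro
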